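import Literature.NumberTheory.NumberFields.RayClassFieldIdelic
import Literature.NumberTheory.NumberFields.PrincipalIdelesFiniteClosure
import HarnessLib

/-!
# The common kernel of the maps `𝔸^×_{f,K}/K^× → C_𝔪(K)` is the kernel of the Artin map; for a CM field an
# element of that kernel with `t · ι t = 1` is principal (Milne, *The fundamental theorem of complex
# multiplication* (2007), proof of Thm. 3.10, last step)

Topic `NumberTheory/NumberFields` (global class field theory, idelic dictionary); namespace
`Literature.NumberTheory.NumberFields`.  Lane `lit-hodgefound` (Track 2, Layer A3 skeleton seat `skel-3`, row A3-G42
FILE 1: the number-theoretic half of the LAST STEP of the proof of the fundamental theorem of complex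
multiplication over the reflex field, Milne 2007 Thm. 3.10 = Milne CM Thm. 9.10).  THEOREMS ONLY, all proved: no
definition, no named fact, no `sorry` (D-0026, net debt 0).

## The print, verbatim

J. S. Milne, *The fundamental theorem of complex multiplication*, arXiv:0705.3446 (2007) [Milne2007FundamentalCM],
§3.4, end of the proof of Theorem 3.10 (held text `paper:arxiv-0705.3446` p0017 L41–L66):

> «The map `η : Gal(ℚ^al/E*) → 𝔸^×_{f,E}/E^×` is a homomorphism, and so it factors through `Gal(ℚ^al/E*)^ab`.
> When combined with the Artin map, it gives a homomorphism `η′ : 𝔸^×_{f,E*}/E*^× → 𝔸^×_{f,E}/E^×`.  Choose an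
> integer `m > 0`. For some modulus `𝔪`, there exist commutative diagrams [`𝔸^×_{f,E*}/E*^× → 𝔸^×_{f,E}/E^×` over
> `C_𝔪(E*) → C_m(E)`, vertical maps onto] with the top map either `N_Φ` or `η′` and the vertical maps the obvious
> maps ([CFT], V 4.6). The bottom maps in the two diagrams agree by Theorem 3.3, which implies that
> `t := η(σ)/N_Φ(s)` lies in the common kernel of the maps `𝔸^×_{f,E}/E^× → C_m(E)` for `m > 0`. But this common
> kernel is equal to the kernel of the Artin map `𝔸^×_{f,E}/E^× → Gal(E^ab/E)`. As `t · ι_E t = 1` (see 3.12),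
> `t = 1` (see 3.6).»

(Milne CM notes, version 2020, §9 p. 80 L8–L18 has the first half verbatim: «the kernels of the homomorphisms
`𝔸^×_{f,E}/E^× → C_m(E)`, as `m` runs over the positive integers, form a basis for the open neighbourhoods of `1` in
`𝔸^×_{f,E}/E^×` (cf. CFT, V, 4.6)», and closes with Lemmas 9.12–9.14 instead of the last sentence.)

## What is proved (tree vocabulary: `K^× = (unitEmbedding (𝓞 K) K).range ≤ (𝔸_{K,f})^×`, `Ē = its topologicalClosure`;
`W_𝔪 = IdeleAction.congruenceUnits 𝔪 ≤ (𝔸_{K,f})^×` (Neukirch's `I^𝔪`, finite part) and `rayUnitIdeles K 𝔪 ≤ 𝕀_K`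
(flt-inv, archimedean components free — Milne's modulus `m` for a CM field has no archimedean part);
`C_𝔪 = rayClassField K 𝔪 ⊆ K̄` with `[a, K]|_{C_𝔪} = 1 ↔ a ∈ K^× · W_𝔪` (flt-inv); `[·, K] = ideleArtinMap K`)

* §1 **THE COMMON KERNEL ON FINITE IDÈLES**: `⋂_{𝔪 ≠ 0} K^× · W_𝔪 = Ē`
  (`mem_topologicalClosure_range_iff_forall_mem_sup_congruenceUnits`; `Ē ⊆ K^× W_𝔪` because an open subgroup is
  closed, `⊇` because the `W_𝔪` are a basis of neighbourhoods of `1`, Neukirch VI (1.8) = the tree's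
  `IdeleAction.exists_congruenceUnits_subset_of_mem_nhds`); the same indexed by the integers `m > 0` («for
  `m > 0`»: `(m) ⊆ 𝔪` for `m = N𝔪`) — `…_iff_forall_nat`.
* §2 **ON `𝕀_K`**: `x ∈ K^× · W_𝔪` (full idèles) `↔ x_𝐡 ∈ K^× · W_𝔪` (finite parts) for every `K`
  (`mem_principalIdeles_sup_rayUnitIdeles_iff`); hence `(∀ 𝔪, [x, K]|_{C_𝔪} = 1) ↔ x_𝐡 ∈ Ē` for every `K`
  (`forall_abRestrict_rayClassField_ideleArtinMap_eq_one_iff`), and **for `K` TOTALLY COMPLEX** (every CM field;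
  then `ker [·, K]` read on finite parts is `Ē`, skel-3 gen 25's `ideleArtinMap_eq_one_iff_finitePart_mem_topologicalClosure`)
  **`ideleArtinMap_eq_one_iff_forall_abRestrict_rayClassField_eq_one`: `[x, K] = 1 ↔ ∀ 𝔪 ≠ 0, [x, K]|_{C_𝔪} = 1`**
  — «this common kernel is equal to the kernel of the Artin map».  For a field with a real place the common
  kernel is strictly larger: `(-1)_∞ ∈ W_𝔪` for every `𝔪` (`infIdele_neg_one_mem_rayUnitIdeles`, `K = ℚ`) while
  `[(-1)_∞, ℚ] ≠ 1` (row A3-G41 FILE 1 `ideleArtinMap_infIdele_neg_one_ne_one`, not imported here).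
* §3 **«As `t · ι_E t = 1`, `t = 1` (see 3.6)»** for `K` a CM field: if `t ∈ Ē` and `t · ρ t = 1` for a continuous
  endomorphism `ρ` of `(𝔸_{K,f})^×` acting as complex conjugation on `K^×` (gen 25's hypotheses, inhabited by the
  transported `ι_E`), then `t ∈ K^×` (`mem_range_of_mem_topologicalClosure_of_mul_map_eq_one`: by LEMMA 3.6 = 9.6
  `ρ t ≡ t (mod K^×)`, so `t⁻² = t⁻¹ ρ t ∈ K^×`, and `Ē/K^×` is uniquely divisible).
* §4 the printed sentence assembled: for `K` CM and `t ∈ (𝔸_{K,f})^×` lying in `K^× · W_𝔪` for every `𝔪 ≠ 0`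
  (resp. every `(m)`, `m > 0`; resp. with `[(1, t), K]|_{C_𝔪} = 1` for every `𝔪`) and `t · ρ t = 1`: `t ∈ K^×`.

NOT HERE: Theorem 3.10 / 9.10 itself, the geometric `η(σ)` and (e3), Lemma 3.12 (= CM notes Lemma 9.14, the Hasse-norm
step), the CM notes' torus `T = 𝔾_m ×_{T_F} T_E` (Lemmas 9.12–9.13, superseded by the 2007 argument).

## References

* J. S. Milne, *The fundamental theorem of complex multiplication*, arXiv:0705.3446 (2007), §3.4, proof of Thm. 3.10
  (last paragraph) and Lemma 3.6. [Milne2007FundamentalCM]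
* J. S. Milne, *Complex Multiplication* (2006; version July 14, 2020), Ch. II §9, pp. 79–80 (proof of Thm. 9.10) and
  Lemma 9.6. [MilneCM2006]
* J. Neukirch, *Algebraic Number Theory* (1999), Ch. VI §1 (1.7)–(1.9), §6 (6.1)–(6.2), §7 (7.1). [NeukirchANT1999]

## Provenance

Lane `lit-hodgefound`, seat `literature-prover-lit-hodgefound-skel-3-g27-0` (row A3-G42, FILE 1).
-/

set_option autoImplicit false

noncomputable section

open NumberField IsDedekindDomain Field Topology

namespace Literature.NumberTheory.NumberFields

open Literature.NumberTheory.GaloisRepresentations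

/-! ## §1. `⋂_𝔪 K^× · W_𝔪 = Ē` in the finite idèle group -/

section Finite

variable (K : Type) [Field K] [NumberField K]

/-- `Ē ⊆ K^× · W_𝔪`: an open subgroup (here `K^× · W_𝔪 ⊇ W_𝔪`) is closed, and this one contains `K^×`.
[cite: NeukirchANT1999, Ch. VI §1 Prop. (1.8)] [cite: Milne2007FundamentalCM, §3.4, proof of Thm. 3.10] -/
theorem topologicalClosure_range_le_sup_congruenceUnits (𝔪 : Ideal (𝓞 K)) :
    (FiniteAdeleRing.unitEmbedding (𝓞 K) K).range.topologicalClosure ≤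
      (FiniteAdeleRing.unitEmbedding (𝓞 K) K).range ⊔ IdeleAction.congruenceUnits (K := K) 𝔪 := by
  refine Subgroup.topologicalClosure_minimal _ le_sup_left ?_
  exact Subgroup.isClosed_of_isOpen _
    (Subgroup.isOpen_mono le_sup_right (IdeleAction.isOpen_congruenceUnits (K := K) 𝔪))

/-- `⋂_{𝔪 ≠ 0} K^× · W_𝔪 ⊆ Ē`: the congruence subgroups `W_𝔪` form a basis of neighbourhoods of `1`.
[cite: NeukirchANT1999, Ch. VI §1 Prop. (1.8)] [cite: Milne2007FundamentalCM, §3.4, proof of Thm. 3.10] -/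
theorem mem_topologicalClosure_range_of_forall_mem_sup_congruenceUnits {u : (FiniteAdeleRing (𝓞 K) K)ˣ}
    (hu : ∀ 𝔪 : Ideal (𝓞 K), 𝔪 ≠ ⊥ →
      u ∈ (FiniteAdeleRing.unitEmbedding (𝓞 K) K).range ⊔ IdeleAction.congruenceUnits (K := K) 𝔪) :
    u ∈ (FiniteAdeleRing.unitEmbedding (𝓞 K) K).range.topologicalClosure := by
  rw [← SetLike.mem_coe, Subgroup.topologicalClosure_coe, mem_closure_iff_nhds]
  intro V hV
  -- `u⁻¹ V` is a neighbourhood of `1`, so it contains some `W_𝔪`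
  have hV1 : (fun y : (FiniteAdeleRing (𝓞 K) K)ˣ => u * y) ⁻¹' V ∈ 𝓝 (1 : (FiniteAdeleRing (𝓞 K) K)ˣ) := by
    refine (continuous_const_mul u).continuousAt.preimage_mem_nhds ?_
    simpa only [mul_one] using hV
  obtain ⟨𝔪, h𝔪, hW⟩ := IdeleAction.exists_congruenceUnits_subset_of_mem_nhds hV1
  obtain ⟨e, he, w, hw, hew⟩ := Subgroup.mem_sup.mp (hu 𝔪 h𝔪)
  refine ⟨e, ?_, he⟩
  have : u * w⁻¹ = e := by rw [← hew, mul_inv_cancel_right]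
  have hmem := hW (inv_mem hw : w⁻¹ ∈ IdeleAction.congruenceUnits (K := K) 𝔪)
  rwa [Set.mem_preimage, this] at hmem

/-- **«The common kernel of the maps `𝔸^×_{f,K}/K^× → C_𝔪(K)` is the kernel of the Artin map», on finite idèles:
`u ∈ Ē ↔ u ∈ K^× · W_𝔪` for every integral ideal `𝔪 ≠ 0`** (`Ē` = the closure of `K^×` = the kernel of `art_K`
on `𝔸^×_{f,K}` for `K` totally imaginary; `K^× · W_𝔪` = the kernel of `𝔸^×_{f,K} → C_𝔪`).
[cite: Milne2007FundamentalCM, §3.4, proof of Thm. 3.10 («this common kernel is equal to the kernel of the Artin map»)]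
[cite: MilneCM2006, Ch. II §9, proof of Thm. 9.10 (p. 80)] -/
theorem mem_topologicalClosure_range_iff_forall_mem_sup_congruenceUnits (u : (FiniteAdeleRing (𝓞 K) K)ˣ) :
    u ∈ (FiniteAdeleRing.unitEmbedding (𝓞 K) K).range.topologicalClosure ↔
      ∀ 𝔪 : Ideal (𝓞 K), 𝔪 ≠ ⊥ →
        u ∈ (FiniteAdeleRing.unitEmbedding (𝓞 K) K).range ⊔ IdeleAction.congruenceUnits (K := K) 𝔪 :=
  ⟨fun hu 𝔪 _ => topologicalClosure_range_le_sup_congruenceUnits K 𝔪 hu,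
    mem_topologicalClosure_range_of_forall_mem_sup_congruenceUnits K⟩

/-- `(m) ⊆ 𝔪` for `m = N𝔪`, so `W_{(N𝔪)} ≤ W_𝔪`: the moduli `(m)`, `m ∈ ℕ_{>0}`, are cofinal («`C_m(E)` for `m > 0`»).
[cite: NeukirchANT1999, Ch. VI §1 Def. (1.7)] -/
theorem congruenceUnits_span_absNorm_le {𝔪 : Ideal (𝓞 K)} (h𝔪 : 𝔪 ≠ ⊥) :
    IdeleAction.congruenceUnits (K := K) (Ideal.span {((Ideal.absNorm 𝔪 : ℕ) : 𝓞 K)}) ≤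
      IdeleAction.congruenceUnits (K := K) 𝔪 := by
  refine FiniteIdeleClosure.congruenceUnits_mono K ?_ ?_
  · rw [Ne, Ideal.span_singleton_eq_bot]
    exact_mod_cast (Ideal.absNorm_eq_zero_iff.not.mpr h𝔪)
  · rw [Ideal.span_singleton_le_iff_mem]
    exact Ideal.absNorm_mem 𝔪

/-- The common kernel indexed by the positive integers («`𝔸^×_{f,E}/E^× → C_m(E)` for `m > 0`»):
`u ∈ Ē ↔ u ∈ K^× · W_{(m)}` for every integer `m > 0`. [cite: Milne2007FundamentalCM, §3.4, proof of Thm. 3.10]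
[cite: MilneCM2006, Ch. II §9, proof of Thm. 9.10 (p. 80) («as m runs over the positive integers»)] -/
theorem mem_topologicalClosure_range_iff_forall_nat (u : (FiniteAdeleRing (𝓞 K) K)ˣ) :
    u ∈ (FiniteAdeleRing.unitEmbedding (𝓞 K) K).range.topologicalClosure ↔
      ∀ m : ℕ, m ≠ 0 →
        u ∈ (FiniteAdeleRing.unitEmbedding (𝓞 K) K).range ⊔
          IdeleAction.congruenceUnits (K := K) (Ideal.span {(m : 𝓞 K)}) := by
  rw [mem_topologicalClosure_range_iff_forall_mem_sup_congruenceUnits]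
  refine ⟨fun h m hm => h _ ?_, fun h 𝔪 h𝔪 => ?_⟩
  · rw [Ne, Ideal.span_singleton_eq_bot]
    exact_mod_cast hm
  · exact sup_le_sup_left (congruenceUnits_span_absNorm_le K h𝔪) _
      (h (Ideal.absNorm 𝔪) (Ideal.absNorm_eq_zero_iff.not.mpr h𝔪))

end Finite

/-! ## §2. On the full idèle group: `⋂_𝔪 K^× · W_𝔪` and the kernel of `[·, K]` -/

section Idele

variable (K : Type) [Field K] [NumberField K]

/-- `x ∈ K^× · W_𝔪 ⊆ 𝕀_K` iff `x_𝐡 ∈ K^× · W_𝔪 ⊆ 𝔸^×_{f,K}` (the archimedean components of `W_𝔪` are free), for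
every number field `K`. [cite: NeukirchANT1999, Ch. VI §1 Def. (1.7)] -/
theorem mem_principalIdeles_sup_rayUnitIdeles_iff (𝔪 : Ideal (𝓞 K)) (x : ideleGroup K) :
    x ∈ principalIdeles K ⊔ rayUnitIdeles K 𝔪 ↔
      IdeleAction.finitePart K x ∈
        (FiniteAdeleRing.unitEmbedding (𝓞 K) K).range ⊔ IdeleAction.congruenceUnits (K := K) 𝔪 := by
  constructor
  · intro h
    obtain ⟨a, ⟨e, rfl⟩, w, hw, rfl⟩ := Subgroup.mem_sup.mp h
    rw [map_mul]
    exact Subgroup.mul_mem_sup ⟨e, (IdeleAction.finitePart_principalIdele K e).symm⟩ hw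
  · intro h
    obtain ⟨a, ⟨e, he⟩, w, hw, hxw⟩ := Subgroup.mem_sup.mp h
    refine Subgroup.mem_sup.mpr ⟨principalIdele K e, ⟨e, rfl⟩, (principalIdele K e)⁻¹ * x, ?_, by
      rw [mul_inv_cancel_left]⟩
    change IdeleAction.finitePart K ((principalIdele K e)⁻¹ * x) ∈ IdeleAction.congruenceUnits (K := K) 𝔪
    rw [map_mul, map_inv, IdeleAction.finitePart_principalIdele, he, ← hxw, inv_mul_cancel_left]
    exact hw

/-- **`x ∈ K^× · W_𝔪` for every `𝔪 ≠ 0` iff `x_𝐡 ∈ Ē`**, for every number field `K`.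
[cite: Milne2007FundamentalCM, §3.4, proof of Thm. 3.10] [cite: NeukirchANT1999, Ch. VI §1 Prop. (1.8)] -/
theorem forall_mem_principalIdeles_sup_rayUnitIdeles_iff (x : ideleGroup K) :
    (∀ 𝔪 : Ideal (𝓞 K), 𝔪 ≠ ⊥ → x ∈ principalIdeles K ⊔ rayUnitIdeles K 𝔪) ↔
      IdeleAction.finitePart K x ∈ (FiniteAdeleRing.unitEmbedding (𝓞 K) K).range.topologicalClosure := by
  rw [mem_topologicalClosure_range_iff_forall_mem_sup_congruenceUnits]
  exact forall₂_congr fun 𝔪 _ => mem_principalIdeles_sup_rayUnitIdeles_iff K 𝔪 x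

/-- **The common kernel of the maps `𝕀_K → G(C_𝔪|K)`, `𝔪 ≠ 0`**, read on finite parts: `[x, K]|_{C_𝔪} = 1` for
every ray class field `C_𝔪` iff `x_𝐡 ∈ Ē` (flt-inv's `[a, K]|_{C_𝔪} = 1 ↔ a ∈ K^× · W_𝔪` and §1), for every number
field `K`. [cite: Milne2007FundamentalCM, §3.4, proof of Thm. 3.10] [cite: NeukirchANT1999, Ch. VI §7 Thm. (7.1)] -/
theorem forall_abRestrict_rayClassField_ideleArtinMap_eq_one_iff (x : ideleGroup K) :
    (∀ 𝔪 : Ideal (𝓞 K), 𝔪 ≠ ⊥ → abRestrict (rayClassField K 𝔪) (ideleArtinMap K x) = 1) ↔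
      IdeleAction.finitePart K x ∈ (FiniteAdeleRing.unitEmbedding (𝓞 K) K).range.topologicalClosure := by
  rw [← forall_mem_principalIdeles_sup_rayUnitIdeles_iff]
  exact forall₂_congr fun 𝔪 _ => abRestrict_ideleArtinMap_rayClassField_eq_one_iff x

/-- **«This common kernel is equal to the kernel of the Artin map»** — for `K` TOTALLY COMPLEX (every CM field):
`[x, K] = 1 ↔ [x, K]|_{C_𝔪} = 1` for every integral ideal `𝔪 ≠ 0`, i.e. the common kernel of the maps
`𝕀_K/K^× → C_𝔪(K) ≅ G(C_𝔪|K)` over all moduli without archimedean part IS the kernel of the Artin map (for `K`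
totally complex `ker [·, K]` is `Ē` on finite parts, gen 25's `ideleArtinMap_eq_one_iff_finitePart_mem_topologicalClosure`;
for a field with a real place the common kernel is strictly larger, `infIdele_neg_one_mem_rayUnitIdeles`).
[cite: Milne2007FundamentalCM, §3.4, proof of Thm. 3.10 («this common kernel is equal to the kernel of the Artin map»)]
[cite: MilneCM2006, Ch. II §9, proof of Thm. 9.10 (p. 80)] -/
theorem ideleArtinMap_eq_one_iff_forall_abRestrict_rayClassField_eq_one [IsTotallyComplex K] (x : ideleGroup K) :
    ideleArtinMap K x = 1 ↔
      ∀ 𝔪 : Ideal (𝓞 K), 𝔪 ≠ ⊥ → abRestrict (rayClassField K 𝔪) (ideleArtinMap K x) = 1 := by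
  rw [forall_abRestrict_rayClassField_ideleArtinMap_eq_one_iff,
    FiniteIdeleClosure.ideleArtinMap_eq_one_iff_finitePart_mem_topologicalClosure]

/-- The same with the subgroups: for `K` totally complex, `[x, K] = 1 ↔ x ∈ K^× · W_𝔪` for every `𝔪 ≠ 0`.
[cite: Milne2007FundamentalCM, §3.4, proof of Thm. 3.10] [cite: NeukirchANT1999, Ch. VI §7 Thm. (7.1)] -/
theorem ideleArtinMap_eq_one_iff_forall_mem_principalIdeles_sup_rayUnitIdeles [IsTotallyComplex K]
    (x : ideleGroup K) :
    ideleArtinMap K x = 1 ↔ ∀ 𝔪 : Ideal (𝓞 K), 𝔪 ≠ ⊥ → x ∈ principalIdeles K ⊔ rayUnitIdeles K 𝔪 := by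
  rw [forall_mem_principalIdeles_sup_rayUnitIdeles_iff,
    FiniteIdeleClosure.ideleArtinMap_eq_one_iff_finitePart_mem_topologicalClosure]

/-- On finite idèles `u ↦ (1, u)`, for `K` totally complex: `[(1, u), K] = 1 ↔ u ∈ K^× · W_𝔪` for every `𝔪 ≠ 0`
(«the common kernel of the maps `𝔸^×_{f,E}/E^× → C_m(E)` … is equal to the kernel of the Artin map
`𝔸^×_{f,E}/E^× → Gal(E^ab/E)`», Milne's form). [cite: Milne2007FundamentalCM, §3.4, proof of Thm. 3.10] -/
theorem ideleArtinMap_units_map_inr_eq_one_iff_forall_mem_sup_congruenceUnits [IsTotallyComplex K]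
    (u : (FiniteAdeleRing (𝓞 K) K)ˣ) :
    ideleArtinMap K (Units.map (N := AdeleRing (𝓞 K) K)
        (MonoidHom.inr (InfiniteAdeleRing K) (FiniteAdeleRing (𝓞 K) K)) u) = 1 ↔
      ∀ 𝔪 : Ideal (𝓞 K), 𝔪 ≠ ⊥ →
        u ∈ (FiniteAdeleRing.unitEmbedding (𝓞 K) K).range ⊔ IdeleAction.congruenceUnits (K := K) 𝔪 := by
  rw [FiniteIdeleClosure.ideleArtinMap_eq_one_iff_finitePart_mem_topologicalClosure,
    mem_topologicalClosure_range_iff_forall_mem_sup_congruenceUnits]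
  exact Iff.rfl

/-- **Scope of the totally-complex hypothesis**: for `K = ℚ` the archimedean idèle `(-1)_∞` lies in `ℚ^× · W_𝔪` —
indeed in `W_𝔪` — for EVERY `𝔪` (the moduli have no archimedean part), although `[(-1)_∞, ℚ]` is complex
conjugation, `≠ 1` (row A3-G41 FILE 1 `ideleArtinMap_infIdele_neg_one_ne_one`): for a field with a real place the
common kernel of the maps to these ray class groups is strictly larger than the kernel of the Artin map.
[cite: NeukirchANT1999, Ch. VI §1 Def. (1.7) (Remark: the real places in the modulus)] -/
theorem infIdele_neg_one_mem_rayUnitIdeles (𝔪 : Ideal (𝓞 ℚ)) : Rat.infIdele (-1) ∈ rayUnitIdeles ℚ 𝔪 := by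
  rw [rayUnitIdeles_eq_comap, Subgroup.mem_comap]
  have : IdeleAction.finitePart ℚ (Rat.infIdele (-1)) = 1 := Units.ext rfl
  rw [this]
  exact one_mem _

end Idele

/-! ## §3. «As `t · ι_E t = 1`, `t = 1`»: a CM field, an element of `Ē` of relative norm one is principal -/

section CM

variable (K : Type) [Field K] [NumberField K] [IsCMField K]
variable (ρ : (FiniteAdeleRing (𝓞 K) K)ˣ →* (FiniteAdeleRing (𝓞 K) K)ˣ) (hρc : Continuous ρ)
  (hρ : ∀ a : Kˣ, ((ρ (FiniteAdeleRing.unitEmbedding (𝓞 K) K a) : (FiniteAdeleRing (𝓞 K) K)ˣ) :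
    FiniteAdeleRing (𝓞 K) K) = algebraMap K (FiniteAdeleRing (𝓞 K) K) (IsCMField.complexConj K (a : K)))
include hρc hρ

/-- **«As `t · ι_E t = 1`, `t = 1` (see Lemma 3.6)»**: for a CM field `K` and `ρ` a continuous endomorphism of the
finite idèle group acting as complex conjugation `ι_E` on the principal idèles, an element `t` of the closure `Ē` of
`K^×` (= the kernel of `art_K` on `𝔸^×_{f,K}/K^×`) with `t · ρ t = 1` lies in `K^×`.  PROOF (Milne's pointer to
3.6 = CM notes 9.6, gen 25's `…PrincipalIdelesFiniteClosure`): `ρ t ≡ t (mod K^×)` («its elements are fixed by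
`ι_E`»: `t⁻¹ ρ t ∈ K^×`), and `ρ t = t⁻¹`, so `t⁻² ∈ K^×`, hence `t² ∈ K^×`, hence `t ∈ K^×` («uniquely divisible»:
`mem_range_of_pow_mem_range`). [cite: Milne2007FundamentalCM, §3.4, proof of Thm. 3.10 and Lemma 3.6]
[cite: MilneCM2006, Ch. II §9, Lemma 9.6] -/
theorem mem_range_of_mem_topologicalClosure_of_mul_map_eq_one {t : (FiniteAdeleRing (𝓞 K) K)ˣ}
    (ht : t ∈ (FiniteAdeleRing.unitEmbedding (𝓞 K) K).range.topologicalClosure) (h1 : t * ρ t = 1) :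
    t ∈ (FiniteAdeleRing.unitEmbedding (𝓞 K) K).range := by
  have hfix := FiniteIdeleClosure.inv_mul_map_mem_range_of_mem_topologicalClosure K ρ hρc hρ ht
  have hρt : ρ t = t⁻¹ := eq_inv_of_mul_eq_one_right h1
  rw [hρt, ← mul_inv, ← pow_two, ← inv_pow] at hfix
  have h2 : t ^ 2 ∈ (FiniteAdeleRing.unitEmbedding (𝓞 K) K).range := by
    have := inv_mem hfix
    rwa [inv_pow, inv_inv] at this
  exact FiniteIdeleClosure.mem_range_of_pow_mem_range K ht two_ne_zero h2

/-! ## §4. The printed sentence assembled -/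

/-- **MILNE 2007, PROOF OF THM. 3.10, LAST STEP — NUMBER-THEORETIC HALF**: for a CM field `K` and `ρ` as above, a
finite idèle `t` which lies in the common kernel of the maps `𝔸^×_{f,K}/K^× → C_𝔪(K)` — `t ∈ K^× · W_𝔪` for every
`𝔪 ≠ 0` — and satisfies `t · ρ t = 1` is principal: `t ∈ K^×` («`t` lies in the common kernel … equal to the kernel
of the Artin map … As `t · ι_E t = 1`, `t = 1`» in `𝔸^×_{f,E}/E^×`).
[cite: Milne2007FundamentalCM, §3.4, proof of Thm. 3.10 (last paragraph)] [cite: MilneCM2006, Ch. II §9, proof of Thm. 9.10] -/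
theorem mem_range_of_forall_mem_sup_congruenceUnits_of_mul_map_eq_one {t : (FiniteAdeleRing (𝓞 K) K)ˣ}
    (ht : ∀ 𝔪 : Ideal (𝓞 K), 𝔪 ≠ ⊥ →
      t ∈ (FiniteAdeleRing.unitEmbedding (𝓞 K) K).range ⊔ IdeleAction.congruenceUnits (K := K) 𝔪)
    (h1 : t * ρ t = 1) : t ∈ (FiniteAdeleRing.unitEmbedding (𝓞 K) K).range :=
  mem_range_of_mem_topologicalClosure_of_mul_map_eq_one K ρ hρc hρ
    (mem_topologicalClosure_range_of_forall_mem_sup_congruenceUnits K ht) h1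

/-- The same with the moduli `(m)`, `m ∈ ℕ_{>0}` («`C_m(E)` for `m > 0`»).
[cite: Milne2007FundamentalCM, §3.4, proof of Thm. 3.10 (last paragraph)] -/
theorem mem_range_of_forall_nat_mem_sup_congruenceUnits_of_mul_map_eq_one {t : (FiniteAdeleRing (𝓞 K) K)ˣ}
    (ht : ∀ m : ℕ, m ≠ 0 →
      t ∈ (FiniteAdeleRing.unitEmbedding (𝓞 K) K).range ⊔ IdeleAction.congruenceUnits (K := K) (Ideal.span {(m : 𝓞 K)}))
    (h1 : t * ρ t = 1) : t ∈ (FiniteAdeleRing.unitEmbedding (𝓞 K) K).range :=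
  mem_range_of_mem_topologicalClosure_of_mul_map_eq_one K ρ hρc hρ
    ((mem_topologicalClosure_range_iff_forall_nat K t).mpr ht) h1

/-- The same through the ray class FIELDS: if `[(1, t), K]|_{C_𝔪} = 1` for every `𝔪 ≠ 0` and `t · ρ t = 1`, then
`t ∈ K^×`. [cite: Milne2007FundamentalCM, §3.4, proof of Thm. 3.10 (last paragraph)] [cite: NeukirchANT1999, Ch. VI §7 Thm. (7.1)] -/
theorem mem_range_of_forall_abRestrict_rayClassField_eq_one_of_mul_map_eq_one {t : (FiniteAdeleRing (𝓞 K) K)ˣ}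
    (ht : ∀ 𝔪 : Ideal (𝓞 K), 𝔪 ≠ ⊥ → abRestrict (rayClassField K 𝔪) (ideleArtinMap K
      (Units.map (N := AdeleRing (𝓞 K) K) (MonoidHom.inr (InfiniteAdeleRing K) (FiniteAdeleRing (𝓞 K) K)) t)) = 1)
    (h1 : t * ρ t = 1) : t ∈ (FiniteAdeleRing.unitEmbedding (𝓞 K) K).range := by
  refine mem_range_of_mem_topologicalClosure_of_mul_map_eq_one K ρ hρc hρ ?_ h1
  have h := (forall_abRestrict_rayClassField_ideleArtinMap_eq_one_iff K _).mp ht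
  exact h

/-- The same from the kernel of the Artin map itself («… equal to the kernel of the Artin map
`𝔸^×_{f,E}/E^× → Gal(E^ab/E)`. As `t · ι_E t = 1`, `t = 1`»): `[(1, t), K] = 1` and `t · ρ t = 1` imply `t ∈ K^×`
(a CM field is totally complex). [cite: Milne2007FundamentalCM, §3.4, proof of Thm. 3.10 (last paragraph)]
[cite: MilneCM2006, Ch. II §9, Lemma 9.6] -/
theorem mem_range_of_ideleArtinMap_eq_one_of_mul_map_eq_one {t : (FiniteAdeleRing (𝓞 K) K)ˣ}
    (ht : ideleArtinMap K
      (Units.map (N := AdeleRing (𝓞 K) K) (MonoidHom.inr (InfiniteAdeleRing K) (FiniteAdeleRing (𝓞 K) K)) t) = 1)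
    (h1 : t * ρ t = 1) : t ∈ (FiniteAdeleRing.unitEmbedding (𝓞 K) K).range := by
  refine mem_range_of_mem_topologicalClosure_of_mul_map_eq_one K ρ hρc hρ ?_ h1
  have h := (FiniteIdeleClosure.ideleArtinMap_eq_one_iff_finitePart_mem_topologicalClosure K _).mp ht
  exact h

end CM

end Literature.NumberTheory.NumberFields

end
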